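import Summits.CriticalPhenomena.PercolationContinuityZ3.Theorems.PercNearOneGluingNoHeavyLowerTailSunflowerPrincipalBottom
import Literature.Probability.Percolation.FourFunctionsProdBernoulli
import HarnessLib

/-!
# `NoHeavyLowerTail` (crux stmt-CriticalPhenomena-4575), abstract sunflower cubic at LAW level: the DAYKIN-CHAIN strata —
# Lemma A `μ(E₁) μ(E₂) μ(E₃) ≤ μ(A)²` (resp. Lemma B) from TWO Ahlswede–Daykin steps, under a meet–join closure
# hypothesis on the petals; hence (C1-law), the `H`/`G`/`T` rows and Kahn's Conjecture 5 on these strata, all `p`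

Support file (seat `prim-ineq-gen-2` gen 29; `--supports stmt-CriticalPhenomena-4575`).  Nothing is asserted about the crux; no
`sorry`, no named facts, standard axioms.  Memo: run/shared/lean/prim/prim-ineq-gen-2/SHARP-FORM-GEN29.md §3.

SETTING.  `μ = prodBernoulli p` on `Set ι`, `ι` finite; a three-petal SUNFLOWER of up-sets `E₁ ∩ E₂ = E₁ ∩ E₃ = E₂ ∩ E₃ = A`; cells
`a = μ A`, `c_i = μ (E_i ∖ A)`, `b = μ (E₁ ∪ E₂ ∪ E₃)ᶜ`, `AG = ab − e₂(c)` (`≥ 0`, Gladkov).  The lane's law-level objects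
(prim-ineq-prove-1 g25/g34, `…SunflowerPrincipalCore`): Lemma A `LA := a·AG − e₃ = a² − Π μ(E_i) ≥ 0`, Lemma B
`LB := b·AG − e₃ = b² − Π μ((E_j ∪ E_k)ᶜ) ≥ 0`, the dichotomy (C1-law) `e₃ ≤ max(a,b)·AG` (CONJECTURE in general; its equality
locus is the θ-join product class `LB = 0` and its dual `LA = 0`), and H-COMB `H = (a+b)AG − e₃ = LA + b·AG = LB + a·AG ≥ 0`.

THIS FILE: a petal-dependent stratum on which Lemma A (resp. B) holds for EVERY `p`, by chaining the four-events form of the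
Ahlswede–Daykin inequality (`Literature…prodBernoulli_fourEvents`) twice:

* `lemmaA_of_meetJoin` — for ANY events `E₁, E₂, E₃, A` with `S ∪ S' ∈ A` (`S ∈ E₁`, `S' ∈ E₂`) and the MEET–JOIN condition
  `(S ∩ S') ∪ S'' ∈ A` (`S ∈ E₁`, `S' ∈ E₂`, `S'' ∈ E₃`):  `μ(E₁) μ(E₂) μ(E₃) ≤ μ(A)²`.
  PROOF: with `W = E₁ ⊼ E₂ = {S ∩ S'}`, Ahlswede–Daykin gives `μ(E₁)μ(E₂) ≤ μ(W)μ(A)` and then `μ(W)μ(E₃) ≤ μ(univ)μ(A) = μ(A)`.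
  (Weaker than asking the lattice MEDIAN of `S, S', S''` to lie in `A`, which is what the three-function Aharoni–Keich
  inequality would need: `(S ∩ S') ∪ S'' ⊇ med(S,S',S'')`.)
* `meetJoin_of_principalCore` — a sunflower of up-sets whose core is a principal filter `{g ⊆ ω}` satisfies the meet–join
  condition (so this file re-proves the three-petal case of prove-1's `PrincipalCore.lemmaA_of_principalCore` in two lines); the
  condition also holds off the Δ-system strata (e.g. core generated by `{0,1,3},{0,2,3},{1,2,3}` with petals `{0,1,2}↦1, {1,3}↦2,
  {2,3}↦3`, memo §3), so the stratum is new.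
* `lemmaA_of_sunflower_meetJoin` and the CELL ROWS for a sunflower of up-sets of a finite cube satisfying the meet–join condition:
  `e3_le_core_mul_AG_of_meetJoin` (Lemma A in cells), `e3_le_max_mul_AG_of_meetJoin` ((C1-law)), `lawH_nonneg_of_meetJoin`
  (H-COMB `(a+b)(ab − e₂) ≥ e₃`), `AG_ge_e3_of_meetJoin` (`G`-row), `sahiE3_compl_nonneg_of_meetJoin` (Kahn's Conjecture 5 /
  Sahi `E₃ ≥ 0` for the three decreasing events `E_iᶜ`) — all unconditional in `p`.
* DUAL (join–meet condition on the down-sets `D_i = (E_j ∪ E_k)ᶜ`: `(S ∪ S') ∩ S'' ∈ B`): `lemmaB_of_joinMeet`,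
  `lemmaB_of_sunflower_joinMeet`, `e3_le_bottom_mul_AG_of_joinMeet`, `e3_le_max_mul_AG_of_joinMeet`, `lawH_nonneg_of_joinMeet`.
-/

noncomputable section

namespace Summit.CriticalPhenomena.PercolationContinuityZ3.Theorems.SunflowerPartition

namespace DaykinChain

open MeasureTheory
open scoped SetFamily
open Literature.Probability.LatticeModels Literature.Probability.Percolation

variable {ι : Type*}

/-! ## Lemma A / Lemma B from two Ahlswede–Daykin steps -/

/-- **Lemma A on the meet–join stratum.**  If `S ∪ S' ∈ A` for all `S ∈ E₁`, `S' ∈ E₂`, and `(S ∩ S') ∪ S'' ∈ A` for all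
`S ∈ E₁`, `S' ∈ E₂`, `S'' ∈ E₃`, then `μ(E₁) μ(E₂) μ(E₃) ≤ μ(A)²` for `μ = prodBernoulli p` — two applications of the
four-events Ahlswede–Daykin inequality through the family of meets `E₁ ⊼ E₂`. [this work] -/
theorem lemmaA_of_meetJoin [Fintype ι] (p : ι → unitInterval) {E₁ E₂ E₃ A : Set (Set ι)}
    (hjoin : ∀ S ∈ E₁, ∀ S' ∈ E₂, S ∪ S' ∈ A)
    (hmj : ∀ S ∈ E₁, ∀ S' ∈ E₂, ∀ S'' ∈ E₃, (S ∩ S') ∪ S'' ∈ A) :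
    (prodBernoulli p).real E₁ * (prodBernoulli p).real E₂ * (prodBernoulli p).real E₃ ≤
      ((prodBernoulli p).real A) ^ 2 := by
  classical
  -- step 1: `μ(E₁) μ(E₂) ≤ μ(E₁ ⊼ E₂) μ(A)`
  have step₁ := prodBernoulli_fourEvents p E₁ E₂ (E₁ ⊼ E₂) A fun a ha b hb =>
    ⟨Set.mem_infs.2 ⟨a, ha, b, hb, rfl⟩, hjoin a ha b hb⟩
  -- step 2: `μ(E₁ ⊼ E₂) μ(E₃) ≤ μ(univ) μ(A)`
  have step₂ := prodBernoulli_fourEvents p (E₁ ⊼ E₂) E₃ Set.univ A fun w hw c hc => by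
    obtain ⟨a, ha, b, hb, rfl⟩ := Set.mem_infs.1 hw
    exact ⟨Set.mem_univ _, hmj a ha b hb c hc⟩
  rw [probReal_univ, one_mul] at step₂
  have h₃ : 0 ≤ (prodBernoulli p).real E₃ := measureReal_nonneg
  have hA : 0 ≤ (prodBernoulli p).real A := measureReal_nonneg
  calc (prodBernoulli p).real E₁ * (prodBernoulli p).real E₂ * (prodBernoulli p).real E₃
      ≤ (prodBernoulli p).real (E₁ ⊼ E₂) * (prodBernoulli p).real A * (prodBernoulli p).real E₃ :=
        mul_le_mul_of_nonneg_right step₁ h₃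
    _ = (prodBernoulli p).real A * ((prodBernoulli p).real (E₁ ⊼ E₂) * (prodBernoulli p).real E₃) := by ring
    _ ≤ (prodBernoulli p).real A * (prodBernoulli p).real A := mul_le_mul_of_nonneg_left step₂ hA
    _ = ((prodBernoulli p).real A) ^ 2 := by ring

/-- **Lemma B on the join–meet stratum** (the order-dual chain).  If `S ∩ S' ∈ B` for all `S ∈ D₁`, `S' ∈ D₂`, and
`(S ∪ S') ∩ S'' ∈ B` for all `S ∈ D₁`, `S' ∈ D₂`, `S'' ∈ D₃`, then `μ(D₁) μ(D₂) μ(D₃) ≤ μ(B)²`. [this work] -/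
theorem lemmaB_of_joinMeet [Fintype ι] (p : ι → unitInterval) {D₁ D₂ D₃ B : Set (Set ι)}
    (hmeet : ∀ S ∈ D₁, ∀ S' ∈ D₂, S ∩ S' ∈ B)
    (hjm : ∀ S ∈ D₁, ∀ S' ∈ D₂, ∀ S'' ∈ D₃, (S ∪ S') ∩ S'' ∈ B) :
    (prodBernoulli p).real D₁ * (prodBernoulli p).real D₂ * (prodBernoulli p).real D₃ ≤
      ((prodBernoulli p).real B) ^ 2 := by
  classical
  have step₁ := prodBernoulli_fourEvents p D₁ D₂ B (D₁ ⊻ D₂) fun a ha b hb =>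
    ⟨hmeet a ha b hb, Set.mem_sups.2 ⟨a, ha, b, hb, rfl⟩⟩
  have step₂ := prodBernoulli_fourEvents p (D₁ ⊻ D₂) D₃ B Set.univ fun v hv c hc => by
    obtain ⟨a, ha, b, hb, rfl⟩ := Set.mem_sups.1 hv
    exact ⟨hjm a ha b hb c hc, Set.mem_univ _⟩
  rw [probReal_univ, mul_one] at step₂
  have h₃ : 0 ≤ (prodBernoulli p).real D₃ := measureReal_nonneg
  have hB : 0 ≤ (prodBernoulli p).real B := measureReal_nonneg
  calc (prodBernoulli p).real D₁ * (prodBernoulli p).real D₂ * (prodBernoulli p).real D₃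
      ≤ (prodBernoulli p).real B * (prodBernoulli p).real (D₁ ⊻ D₂) * (prodBernoulli p).real D₃ :=
        mul_le_mul_of_nonneg_right step₁ h₃
    _ = (prodBernoulli p).real B * ((prodBernoulli p).real (D₁ ⊻ D₂) * (prodBernoulli p).real D₃) := by ring
    _ ≤ (prodBernoulli p).real B * (prodBernoulli p).real B := mul_le_mul_of_nonneg_left step₂ hB
    _ = ((prodBernoulli p).real B) ^ 2 := by ring

/-! ## Sunflowers of up-sets: the structural hypotheses -/

/-- For up-sets `E₁, E₂` with `E₁ ∩ E₂ = A`, unions `S ∪ S'` (`S ∈ E₁`, `S' ∈ E₂`) lie in the core. [this work] -/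
theorem union_mem_core {E₁ E₂ A : Set (Set ι)} (h₁ : IsUpperSet E₁) (h₂ : IsUpperSet E₂) (h12 : E₁ ∩ E₂ = A)
    {S S' : Set ι} (hS : S ∈ E₁) (hS' : S' ∈ E₂) : S ∪ S' ∈ A := by
  rw [← h12]
  exact ⟨h₁ Set.subset_union_left hS, h₂ Set.subset_union_right hS'⟩

/-- For up-sets `E₁, E₂, E₃`, intersections of members of the down-sets `(E₂ ∪ E₃)ᶜ`, `(E₁ ∪ E₃)ᶜ` lie in the bottom cell
`(E₁ ∪ E₂ ∪ E₃)ᶜ`. [this work] -/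
theorem inter_mem_bottom {E₁ E₂ E₃ : Set (Set ι)} (h₁ : IsUpperSet E₁) (h₂ : IsUpperSet E₂) (h₃ : IsUpperSet E₃)
    {S S' : Set ι} (hS : S ∈ (E₂ ∪ E₃)ᶜ) (hS' : S' ∈ (E₁ ∪ E₃)ᶜ) : S ∩ S' ∈ (E₁ ∪ E₂ ∪ E₃)ᶜ := by
  simp only [Set.mem_compl_iff, Set.mem_union, not_or] at hS hS' ⊢
  exact ⟨⟨fun h => hS'.1 (h₁ Set.inter_subset_right h), fun h => hS.1 (h₂ Set.inter_subset_left h)⟩,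
    fun h => hS.2 (h₃ Set.inter_subset_left h)⟩

/-- **Principal cores satisfy the meet–join condition**: if the pairwise intersections of the up-sets `E_i` lie in the principal
filter `A = {g ⊆ ω}` (and `A ⊆ E₃`... is not even needed), then `(S ∩ S') ∪ S'' ⊇ g`: indeed `S ∪ S'' ⊇ g` and `S' ∪ S'' ⊇ g` force
`g ∖ S'' ⊆ S ∩ S'`.  So `lemmaA_of_sunflower_meetJoin` contains the three-petal case of `PrincipalCore.lemmaA_of_principalCore`.
[this work] -/
theorem meetJoin_of_principalCore {E₁ E₂ E₃ A : Set (Set ι)} (h₁ : IsUpperSet E₁) (h₂ : IsUpperSet E₂)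
    (h₃ : IsUpperSet E₃) (g : Finset ι) (hA : A = {ω | (g : Set ι) ⊆ ω}) (h13 : E₁ ∩ E₃ ⊆ A) (h23 : E₂ ∩ E₃ ⊆ A) :
    ∀ S ∈ E₁, ∀ S' ∈ E₂, ∀ S'' ∈ E₃, (S ∩ S') ∪ S'' ∈ A := by
  intro S hS S' hS' S'' hS''
  rw [hA]
  have h1 : (g : Set ι) ⊆ S ∪ S'' := by
    have : S ∪ S'' ∈ A := h13 ⟨h₁ Set.subset_union_left hS, h₃ Set.subset_union_right hS''⟩
    rw [hA] at this; exact this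
  have h2 : (g : Set ι) ⊆ S' ∪ S'' := by
    have : S' ∪ S'' ∈ A := h23 ⟨h₂ Set.subset_union_left hS', h₃ Set.subset_union_right hS''⟩
    rw [hA] at this; exact this
  intro e he
  rcases h1 he with heS | heS''
  · rcases h2 he with heS' | heS''
    · exact Or.inl ⟨heS, heS'⟩
    · exact Or.inr heS''
  · exact Or.inr heS''

/-- **Lemma A for a sunflower of up-sets on the meet–join stratum**: `μ(E₁) μ(E₂) μ(E₃) ≤ μ(A)²`, every `p`. [this work] -/
theorem lemmaA_of_sunflower_meetJoin [Fintype ι] (p : ι → unitInterval) {E₁ E₂ E₃ A : Set (Set ι)}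
    (h₁ : IsUpperSet E₁) (h₂ : IsUpperSet E₂) (h12 : E₁ ∩ E₂ = A) (hmj : ∀ S ∈ E₁, ∀ S' ∈ E₂, ∀ S'' ∈ E₃, (S ∩ S') ∪ S'' ∈ A) :
    (prodBernoulli p).real E₁ * (prodBernoulli p).real E₂ * (prodBernoulli p).real E₃ ≤
      ((prodBernoulli p).real A) ^ 2 :=
  lemmaA_of_meetJoin p (fun _ hS _ hS' => union_mem_core h₁ h₂ h12 hS hS') hmj

/-- **Lemma B for three up-sets on the join–meet stratum**: with `D_i = (E_j ∪ E_k)ᶜ` and `B = (E₁ ∪ E₂ ∪ E₃)ᶜ`,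
`μ(D₁) μ(D₂) μ(D₃) ≤ μ(B)²`, every `p` (no sunflower condition needed). [this work] -/
theorem lemmaB_of_sunflower_joinMeet [Fintype ι] (p : ι → unitInterval) {E₁ E₂ E₃ : Set (Set ι)}
    (h₁ : IsUpperSet E₁) (h₂ : IsUpperSet E₂) (h₃ : IsUpperSet E₃) (hjm : ∀ S ∈ (E₂ ∪ E₃)ᶜ, ∀ S' ∈ (E₁ ∪ E₃)ᶜ, ∀ S'' ∈ (E₁ ∪ E₂)ᶜ, (S ∪ S') ∩ S'' ∈ (E₁ ∪ E₂ ∪ E₃)ᶜ) :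
    (prodBernoulli p).real (E₂ ∪ E₃)ᶜ * (prodBernoulli p).real (E₁ ∪ E₃)ᶜ * (prodBernoulli p).real (E₁ ∪ E₂)ᶜ ≤
      ((prodBernoulli p).real (E₁ ∪ E₂ ∪ E₃)ᶜ) ^ 2 :=
  lemmaB_of_joinMeet p (fun _ hS _ hS' => inter_mem_bottom h₁ h₂ h₃ hS hS') hjm

/-! ## The law-level rows in cells -/

section Cells

variable [Fintype ι]

/-- **Lemma A in cells** on the meet–join stratum: `c₁c₂c₃ ≤ a·(ab − (c₁c₂ + c₁c₃ + c₂c₃))`, every `p`. [this work] -/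
theorem e3_le_core_mul_AG_of_meetJoin (p : ι → unitInterval) {E₁ E₂ E₃ A : Set (Set ι)} (h₁ : IsUpperSet E₁)
    (h₂ : IsUpperSet E₂) (h12 : E₁ ∩ E₂ = A) (h13 : E₁ ∩ E₃ = A) (h23 : E₂ ∩ E₃ = A) (hmj : ∀ S ∈ E₁, ∀ S' ∈ E₂, ∀ S'' ∈ E₃, (S ∩ S') ∪ S'' ∈ A) :
    (prodBernoulli p).real (E₁ \ A) * (prodBernoulli p).real (E₂ \ A) * (prodBernoulli p).real (E₃ \ A) ≤
      (prodBernoulli p).real A * ((prodBernoulli p).real A * (prodBernoulli p).real (E₁ ∪ E₂ ∪ E₃)ᶜ -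
        ((prodBernoulli p).real (E₁ \ A) * (prodBernoulli p).real (E₂ \ A) +
          (prodBernoulli p).real (E₁ \ A) * (prodBernoulli p).real (E₃ \ A) +
          (prodBernoulli p).real (E₂ \ A) * (prodBernoulli p).real (E₃ \ A))) := by
  have key := lemmaA_of_sunflower_meetJoin p h₁ h₂ h12 hmj
  obtain ⟨e₁, e₂, e₃, eB⟩ := PrincipalCore.cells_eq p h12 h13 h23
  rw [e₁, e₂, e₃] at key
  rw [eB]
  nlinarith [key]

/-- **(C1-law) on the meet–join stratum**: `e₃ ≤ max(a,b)·(ab − e₂)`, every `p`. [this work] -/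
theorem e3_le_max_mul_AG_of_meetJoin (p : ι → unitInterval) {E₁ E₂ E₃ A : Set (Set ι)} (h₁ : IsUpperSet E₁)
    (h₂ : IsUpperSet E₂) (h₃ : IsUpperSet E₃) (h12 : E₁ ∩ E₂ = A) (h13 : E₁ ∩ E₃ = A) (h23 : E₂ ∩ E₃ = A)
    (hmj : ∀ S ∈ E₁, ∀ S' ∈ E₂, ∀ S'' ∈ E₃, (S ∩ S') ∪ S'' ∈ A) :
    (prodBernoulli p).real (E₁ \ A) * (prodBernoulli p).real (E₂ \ A) * (prodBernoulli p).real (E₃ \ A) ≤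
      max ((prodBernoulli p).real A) ((prodBernoulli p).real (E₁ ∪ E₂ ∪ E₃)ᶜ) *
        ((prodBernoulli p).real A * (prodBernoulli p).real (E₁ ∪ E₂ ∪ E₃)ᶜ -
          ((prodBernoulli p).real (E₁ \ A) * (prodBernoulli p).real (E₂ \ A) +
            (prodBernoulli p).real (E₁ \ A) * (prodBernoulli p).real (E₃ \ A) +
            (prodBernoulli p).real (E₂ \ A) * (prodBernoulli p).real (E₃ \ A))) := by
  have hLA := e3_le_core_mul_AG_of_meetJoin p h₁ h₂ h12 h13 h23 hmj
  have hAG := prodBernoulli_strongHarris_sunflower_three p h₁ h₂ h₃ h12 h13 h23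
  have hmax : (prodBernoulli p).real A ≤ max ((prodBernoulli p).real A) ((prodBernoulli p).real (E₁ ∪ E₂ ∪ E₃)ᶜ) :=
    le_max_left _ _
  nlinarith [hmax, hAG, hLA]

/-- **H-COMB on the meet–join stratum**: `(a + b)(ab − e₂) ≥ e₃`, every `p` (`H = LA + b·AG`). [this work] -/
theorem lawH_nonneg_of_meetJoin (p : ι → unitInterval) {E₁ E₂ E₃ A : Set (Set ι)} (h₁ : IsUpperSet E₁)
    (h₂ : IsUpperSet E₂) (h₃ : IsUpperSet E₃) (h12 : E₁ ∩ E₂ = A) (h13 : E₁ ∩ E₃ = A) (h23 : E₂ ∩ E₃ = A)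
    (hmj : ∀ S ∈ E₁, ∀ S' ∈ E₂, ∀ S'' ∈ E₃, (S ∩ S') ∪ S'' ∈ A) :
    0 ≤ ((prodBernoulli p).real A + (prodBernoulli p).real (E₁ ∪ E₂ ∪ E₃)ᶜ) *
        ((prodBernoulli p).real A * (prodBernoulli p).real (E₁ ∪ E₂ ∪ E₃)ᶜ -
          ((prodBernoulli p).real (E₁ \ A) * (prodBernoulli p).real (E₂ \ A) +
            (prodBernoulli p).real (E₁ \ A) * (prodBernoulli p).real (E₃ \ A) +
            (prodBernoulli p).real (E₂ \ A) * (prodBernoulli p).real (E₃ \ A))) -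
      (prodBernoulli p).real (E₁ \ A) * (prodBernoulli p).real (E₂ \ A) * (prodBernoulli p).real (E₃ \ A) := by
  have hLA := e3_le_core_mul_AG_of_meetJoin p h₁ h₂ h12 h13 h23 hmj
  have hAG := prodBernoulli_strongHarris_sunflower_three p h₁ h₂ h₃ h12 h13 h23
  have hb : 0 ≤ (prodBernoulli p).real (E₁ ∪ E₂ ∪ E₃)ᶜ := measureReal_nonneg
  nlinarith [hb, hAG, hLA]

/-- **The `G`-row on the meet–join stratum**: `ab − e₂ ≥ e₃` (Lemma A and `a ≤ 1`). [this work] -/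
theorem AG_ge_e3_of_meetJoin (p : ι → unitInterval) {E₁ E₂ E₃ A : Set (Set ι)} (h₁ : IsUpperSet E₁)
    (h₂ : IsUpperSet E₂) (h₃ : IsUpperSet E₃) (h12 : E₁ ∩ E₂ = A) (h13 : E₁ ∩ E₃ = A) (h23 : E₂ ∩ E₃ = A)
    (hmj : ∀ S ∈ E₁, ∀ S' ∈ E₂, ∀ S'' ∈ E₃, (S ∩ S') ∪ S'' ∈ A) :
    (prodBernoulli p).real (E₁ \ A) * (prodBernoulli p).real (E₂ \ A) * (prodBernoulli p).real (E₃ \ A) ≤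
      (prodBernoulli p).real A * (prodBernoulli p).real (E₁ ∪ E₂ ∪ E₃)ᶜ -
        ((prodBernoulli p).real (E₁ \ A) * (prodBernoulli p).real (E₂ \ A) +
          (prodBernoulli p).real (E₁ \ A) * (prodBernoulli p).real (E₃ \ A) +
          (prodBernoulli p).real (E₂ \ A) * (prodBernoulli p).real (E₃ \ A)) := by
  have hLA := e3_le_core_mul_AG_of_meetJoin p h₁ h₂ h12 h13 h23 hmj
  have hAG := prodBernoulli_strongHarris_sunflower_three p h₁ h₂ h₃ h12 h13 h23
  have ha1 : (prodBernoulli p).real A ≤ 1 := measureReal_le_one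
  have ha0 : 0 ≤ (prodBernoulli p).real A := measureReal_nonneg
  nlinarith [ha1, ha0, hAG, hLA]

/-- **Kahn's Conjecture 5 / Sahi `E₃ ≥ 0` for the complements** of a meet–join sunflower of up-sets:
`E₃(E₁ᶜ,E₂ᶜ,E₃ᶜ) = (1 + a)(ab − e₂) − e₃ ≥ LA ≥ 0`, every `p`. [this work] -/
theorem sahiE3_compl_nonneg_of_meetJoin (p : ι → unitInterval) {E₁ E₂ E₃ A : Set (Set ι)} (h₁ : IsUpperSet E₁)
    (h₂ : IsUpperSet E₂) (h₃ : IsUpperSet E₃) (h12 : E₁ ∩ E₂ = A) (h13 : E₁ ∩ E₃ = A) (h23 : E₂ ∩ E₃ = A)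
    (hmj : ∀ S ∈ E₁, ∀ S' ∈ E₂, ∀ S'' ∈ E₃, (S ∩ S') ∪ S'' ∈ A) :
    0 ≤ sahiE3 (prodBernoulli p) E₁ᶜ E₂ᶜ E₃ᶜ := by
  classical
  have m₁ : MeasurableSet E₁ := MeasurableSet.of_discrete
  have m₂ : MeasurableSet E₂ := MeasurableSet.of_discrete
  have m₃ : MeasurableSet E₃ := MeasurableSet.of_discrete
  rw [sahiE3_compl_sunflower_eq (prodBernoulli p) m₁ m₂ m₃ h12 h13 h23]
  have hLA := e3_le_core_mul_AG_of_meetJoin p h₁ h₂ h12 h13 h23 hmj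
  have hAG := prodBernoulli_strongHarris_sunflower_three p h₁ h₂ h₃ h12 h13 h23
  have ha0 : 0 ≤ (prodBernoulli p).real A := measureReal_nonneg
  nlinarith [ha0, hAG, hLA]

/-! ### Dual rows (join–meet stratum, Lemma B) -/

/-- **Lemma B in cells** on the join–meet stratum: `c₁c₂c₃ ≤ b·(ab − e₂)`, every `p`. [this work] -/
theorem e3_le_bottom_mul_AG_of_joinMeet (p : ι → unitInterval) {E₁ E₂ E₃ A : Set (Set ι)} (h₁ : IsUpperSet E₁)
    (h₂ : IsUpperSet E₂) (h₃ : IsUpperSet E₃) (h12 : E₁ ∩ E₂ = A) (h13 : E₁ ∩ E₃ = A) (h23 : E₂ ∩ E₃ = A)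
    (hjm : ∀ S ∈ (E₂ ∪ E₃)ᶜ, ∀ S' ∈ (E₁ ∪ E₃)ᶜ, ∀ S'' ∈ (E₁ ∪ E₂)ᶜ, (S ∪ S') ∩ S'' ∈ (E₁ ∪ E₂ ∪ E₃)ᶜ) :
    (prodBernoulli p).real (E₁ \ A) * (prodBernoulli p).real (E₂ \ A) * (prodBernoulli p).real (E₃ \ A) ≤
      (prodBernoulli p).real (E₁ ∪ E₂ ∪ E₃)ᶜ * ((prodBernoulli p).real A * (prodBernoulli p).real (E₁ ∪ E₂ ∪ E₃)ᶜ -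
        ((prodBernoulli p).real (E₁ \ A) * (prodBernoulli p).real (E₂ \ A) +
          (prodBernoulli p).real (E₁ \ A) * (prodBernoulli p).real (E₃ \ A) +
          (prodBernoulli p).real (E₂ \ A) * (prodBernoulli p).real (E₃ \ A))) := by
  have key := lemmaB_of_sunflower_joinMeet p h₁ h₂ h₃ hjm
  obtain ⟨d₁, d₂, d₃⟩ := PrincipalCore.cells_eq' p h12 h13 h23
  obtain ⟨-, -, -, eB⟩ := PrincipalCore.cells_eq p h12 h13 h23
  rw [d₁, d₂, d₃] at key
  have ha : (prodBernoulli p).real A = 1 - (prodBernoulli p).real (E₁ ∪ E₂ ∪ E₃)ᶜ - (prodBernoulli p).real (E₁ \ A)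
      - (prodBernoulli p).real (E₂ \ A) - (prodBernoulli p).real (E₃ \ A) := by linarith
  rw [ha]
  nlinarith [key]

/-- **(C1-law) on the join–meet stratum**: `e₃ ≤ max(a,b)·(ab − e₂)`, every `p`. [this work] -/
theorem e3_le_max_mul_AG_of_joinMeet (p : ι → unitInterval) {E₁ E₂ E₃ A : Set (Set ι)} (h₁ : IsUpperSet E₁)
    (h₂ : IsUpperSet E₂) (h₃ : IsUpperSet E₃) (h12 : E₁ ∩ E₂ = A) (h13 : E₁ ∩ E₃ = A) (h23 : E₂ ∩ E₃ = A)
    (hjm : ∀ S ∈ (E₂ ∪ E₃)ᶜ, ∀ S' ∈ (E₁ ∪ E₃)ᶜ, ∀ S'' ∈ (E₁ ∪ E₂)ᶜ, (S ∪ S') ∩ S'' ∈ (E₁ ∪ E₂ ∪ E₃)ᶜ) :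
    (prodBernoulli p).real (E₁ \ A) * (prodBernoulli p).real (E₂ \ A) * (prodBernoulli p).real (E₃ \ A) ≤
      max ((prodBernoulli p).real A) ((prodBernoulli p).real (E₁ ∪ E₂ ∪ E₃)ᶜ) *
        ((prodBernoulli p).real A * (prodBernoulli p).real (E₁ ∪ E₂ ∪ E₃)ᶜ -
          ((prodBernoulli p).real (E₁ \ A) * (prodBernoulli p).real (E₂ \ A) +
            (prodBernoulli p).real (E₁ \ A) * (prodBernoulli p).real (E₃ \ A) +
            (prodBernoulli p).real (E₂ \ A) * (prodBernoulli p).real (E₃ \ A))) := by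
  have hLB := e3_le_bottom_mul_AG_of_joinMeet p h₁ h₂ h₃ h12 h13 h23 hjm
  have hAG := prodBernoulli_strongHarris_sunflower_three p h₁ h₂ h₃ h12 h13 h23
  have hmax : (prodBernoulli p).real (E₁ ∪ E₂ ∪ E₃)ᶜ ≤
      max ((prodBernoulli p).real A) ((prodBernoulli p).real (E₁ ∪ E₂ ∪ E₃)ᶜ) := le_max_right _ _
  nlinarith [hmax, hAG, hLB]

/-- **H-COMB on the join–meet stratum**: `(a + b)(ab − e₂) ≥ e₃`, every `p` (`H = LB + a·AG`). [this work] -/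
theorem lawH_nonneg_of_joinMeet (p : ι → unitInterval) {E₁ E₂ E₃ A : Set (Set ι)} (h₁ : IsUpperSet E₁)
    (h₂ : IsUpperSet E₂) (h₃ : IsUpperSet E₃) (h12 : E₁ ∩ E₂ = A) (h13 : E₁ ∩ E₃ = A) (h23 : E₂ ∩ E₃ = A)
    (hjm : ∀ S ∈ (E₂ ∪ E₃)ᶜ, ∀ S' ∈ (E₁ ∪ E₃)ᶜ, ∀ S'' ∈ (E₁ ∪ E₂)ᶜ, (S ∪ S') ∩ S'' ∈ (E₁ ∪ E₂ ∪ E₃)ᶜ) :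
    0 ≤ ((prodBernoulli p).real A + (prodBernoulli p).real (E₁ ∪ E₂ ∪ E₃)ᶜ) *
        ((prodBernoulli p).real A * (prodBernoulli p).real (E₁ ∪ E₂ ∪ E₃)ᶜ -
          ((prodBernoulli p).real (E₁ \ A) * (prodBernoulli p).real (E₂ \ A) +
            (prodBernoulli p).real (E₁ \ A) * (prodBernoulli p).real (E₃ \ A) +
            (prodBernoulli p).real (E₂ \ A) * (prodBernoulli p).real (E₃ \ A))) -
      (prodBernoulli p).real (E₁ \ A) * (prodBernoulli p).real (E₂ \ A) * (prodBernoulli p).real (E₃ \ A) := by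
  have hLB := e3_le_bottom_mul_AG_of_joinMeet p h₁ h₂ h₃ h12 h13 h23 hjm
  have hAG := prodBernoulli_strongHarris_sunflower_three p h₁ h₂ h₃ h12 h13 h23
  have ha : 0 ≤ (prodBernoulli p).real A := measureReal_nonneg
  nlinarith [ha, hAG, hLB]

/-- **Kahn's Conjecture 5 / Sahi `E₃ ≥ 0` for the complements** on the join–meet stratum:
`E₃(E₁ᶜ,E₂ᶜ,E₃ᶜ) = (1 + a)(ab − e₂) − e₃ = LB + (1 + a − b)(ab − e₂) ≥ 0`, every `p`. [this work] -/
theorem sahiE3_compl_nonneg_of_joinMeet (p : ι → unitInterval) {E₁ E₂ E₃ A : Set (Set ι)} (h₁ : IsUpperSet E₁)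
    (h₂ : IsUpperSet E₂) (h₃ : IsUpperSet E₃) (h12 : E₁ ∩ E₂ = A) (h13 : E₁ ∩ E₃ = A) (h23 : E₂ ∩ E₃ = A)
    (hjm : ∀ S ∈ (E₂ ∪ E₃)ᶜ, ∀ S' ∈ (E₁ ∪ E₃)ᶜ, ∀ S'' ∈ (E₁ ∪ E₂)ᶜ, (S ∪ S') ∩ S'' ∈ (E₁ ∪ E₂ ∪ E₃)ᶜ) :
    0 ≤ sahiE3 (prodBernoulli p) E₁ᶜ E₂ᶜ E₃ᶜ := by
  classical
  have m₁ : MeasurableSet E₁ := MeasurableSet.of_discrete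
  have m₂ : MeasurableSet E₂ := MeasurableSet.of_discrete
  have m₃ : MeasurableSet E₃ := MeasurableSet.of_discrete
  rw [sahiE3_compl_sunflower_eq (prodBernoulli p) m₁ m₂ m₃ h12 h13 h23]
  have hLB := e3_le_bottom_mul_AG_of_joinMeet p h₁ h₂ h₃ h12 h13 h23 hjm
  have hAG := prodBernoulli_strongHarris_sunflower_three p h₁ h₂ h₃ h12 h13 h23
  have hb1 : (prodBernoulli p).real (E₁ ∪ E₂ ∪ E₃)ᶜ ≤ 1 := measureReal_le_one
  have ha0 : 0 ≤ (prodBernoulli p).real A := measureReal_nonneg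
  nlinarith [hb1, ha0, hAG, hLB]

end Cells

end DaykinChain

end Summit.CriticalPhenomena.PercolationContinuityZ3.Theorems.SunflowerPartition

end
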